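import Summits.ResolutionOfSingularities.ResolutionOfSingularities.Theorems.FrobeniusLadderFInjectiveMacaulayficationFedderPointReductions
import Literature.RingTheory.MvPolynomial.VariableIdeals
import Mathlib.RingTheory.MvPolynomial.WeightedHomogeneous
import Mathlib.LinearAlgebra.Matrix.NonsingularInverse
import Mathlib.Algebra.MvPolynomial.Monad
import HarnessLib

/-!
# The toric chart Fedder theorem, part B4: the chart identity (crux `FInjectiveMacaulayfication`, toward `toricChart_fedder`)

[OURS · L1 W4.5a] Support file for crux stmt-ResolutionOfSingularities-15315, seat table v5 (stub-1 (b)).  For a unimodular exponent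
matrix `V`, the chart map `θ : X_j ↦ ∏ᵢ Yᵢ ^ V i j` is `Finsupp.mapDomain` along the INJECTIVE exponent map `m ↦ V·m`; hence the
coefficients of `θ f` are those of `f` (`coeff_theta_apply`, `coeff_theta_eq_zero`), and from a factorisation `θ f = Y^d · g` one reads off
the relation between the monomials of `f` and of `g` (`le_and_coeff_of_factor`, `exists_of_coeff_ne_zero_of_factor`); with
`coeff_substZero` (setting the exceptional coordinates `Y_S` to zero) this gives **THE CHART IDENTITY**
`monomial_mul_substZero_eq_theta_component`: `Y^d · g(Y_S = 0) = θ(in_w f)` for the face weight `w = Σ_{i∈S} vᵢ` (`weight_face_eq`) and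
`D = Σ_{i∈S} dᵢ`, which is the `w`-initial degree of `f` under face compatibility (`isInitialDegree_face`).  These are the inputs B4 of
idea-2's `toricChart_fedder` (assembled in the companion file with B1/B2 `FedderPointReductions` and B3 `MonomialChartFrobeniusTransport`).
No definition is declared; AI-written, weaker than expert review; no statement of [claim: Hironaka2017] is used. [folklore]
-/

-- single-problem summit: the doubled namespace component is forced
set_option linter.dupNamespace false

noncomputable section

namespace Summit.ResolutionOfSingularities.ResolutionOfSingularities.Theorems.FInjectiveMacaulayfication.ToricChartFedder

open MvPolynomial

variable {k : Type} [CommRing k] {n : ℕ}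

/-- The exponent map `m ↦ V·m` of the chart, as a finitely supported function. [folklore] -/
theorem expMap_apply (V : Matrix (Fin n) (Fin n) ℕ) (m : Fin n →₀ ℕ) (i : Fin n) :
    (Finsupp.equivFunOnFinite.symm (V.mulVec ⇑m) : Fin n →₀ ℕ) i = ∑ j, V i j * m j := by
  rw [Finsupp.coe_equivFunOnFinite_symm]
  rfl

/-- **The chart map on monomials**: `θ (monomial m c) = monomial (V·m) c`. [folklore] -/
theorem theta_monomial (V : Matrix (Fin n) (Fin n) ℕ) (m : Fin n →₀ ℕ) (c : k) :
    aeval (fun j : Fin n => ∏ i : Fin n, (X i : MvPolynomial (Fin n) k) ^ V i j) (monomial m c) =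
      monomial (Finsupp.equivFunOnFinite.symm (V.mulVec ⇑m)) c := by
  rw [aeval_monomial, algebraMap_eq, monomial_eq]
  congr 1
  -- `∏_j (∏_i Xᵢ ^ V i j) ^ m j = ∏_i Xᵢ ^ (Σ_j V i j * m j)`
  rw [Finsupp.prod_fintype _ _ (fun j => by simp), Finsupp.prod_fintype _ _ (fun i => by simp)]
  have h1 : ∀ j, (∏ i : Fin n, (X i : MvPolynomial (Fin n) k) ^ V i j) ^ (m j) =
      ∏ i : Fin n, (X i : MvPolynomial (Fin n) k) ^ (V i j * m j) := fun j => by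
    rw [← Finset.prod_pow]
    refine Finset.prod_congr rfl fun i _ => ?_
    rw [pow_mul]
  simp_rw [h1]
  rw [Finset.prod_comm]
  refine Finset.prod_congr rfl fun i _ => ?_
  rw [expMap_apply, Finset.prod_pow_eq_pow_sum]

/-- **The chart map is injective on exponents** for `V` unimodular: `V·m = V·m' ⇒ m = m'`. [folklore] -/
theorem expMap_injective (V : Matrix (Fin n) (Fin n) ℕ) (hV : IsUnit (V.map (Nat.cast : ℕ → ℤ)).det) :
    Function.Injective (fun m : Fin n →₀ ℕ => (Finsupp.equivFunOnFinite.symm (V.mulVec ⇑m) : Fin n →₀ ℕ)) := by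
  intro m m' h
  have h1 : ∀ i, (∑ j, V i j * m j : ℕ) = ∑ j, V i j * m' j := fun i => by
    have := DFunLike.congr_fun h i
    rwa [expMap_apply, expMap_apply] at this
  -- cast to `ℤ` and multiply by the inverse matrix
  set Vz : Matrix (Fin n) (Fin n) ℤ := V.map (Nat.cast : ℕ → ℤ) with hVz
  have h2 : Vz.mulVec (fun j => (m j : ℤ)) = Vz.mulVec (fun j => (m' j : ℤ)) := by
    funext i
    have := congrArg (Nat.cast : ℕ → ℤ) (h1 i)
    push_cast at this
    simpa [Matrix.mulVec, dotProduct, hVz] using this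
  have h3 : (fun j => (m j : ℤ)) = fun j => (m' j : ℤ) := by
    have := congrArg (Vz⁻¹.mulVec) h2
    rwa [Matrix.mulVec_mulVec, Matrix.mulVec_mulVec, Matrix.nonsing_inv_mul Vz hV, Matrix.one_mulVec,
      Matrix.one_mulVec] at this
  ext j
  exact_mod_cast congrFun h3 j

/-- The chart map as a sum over the support: `θ f = Σ_{m ∈ supp f} monomial (V·m) (coeff m f)`. [folklore] -/
theorem theta_eq_sum (V : Matrix (Fin n) (Fin n) ℕ) (f : MvPolynomial (Fin n) k) :
    aeval (fun j : Fin n => ∏ i : Fin n, (X i : MvPolynomial (Fin n) k) ^ V i j) f =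
      ∑ m ∈ f.support, monomial (Finsupp.equivFunOnFinite.symm (V.mulVec ⇑m)) (coeff m f) := by
  conv_lhs => rw [f.as_sum, map_sum]
  refine Finset.sum_congr rfl fun m _ => ?_
  rw [theta_monomial]

/-- **Coefficients of `θ f` on the image of the exponent map** (`V` unimodular): `coeff (V·m) (θ f) = coeff m f`. [folklore] -/
theorem coeff_theta_apply (V : Matrix (Fin n) (Fin n) ℕ) (hV : IsUnit (V.map (Nat.cast : ℕ → ℤ)).det)
    (f : MvPolynomial (Fin n) k) (m : Fin n →₀ ℕ) :
    coeff (Finsupp.equivFunOnFinite.symm (V.mulVec ⇑m)) (aeval (fun j : Fin n => ∏ i : Fin n,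
      (X i : MvPolynomial (Fin n) k) ^ V i j) f) = coeff m f := by
  classical
  rw [theta_eq_sum, coeff_sum]
  by_cases hm : m ∈ f.support
  · rw [Finset.sum_eq_single m]
    · rw [coeff_monomial, if_pos rfl]
    · intro m' _ hne
      rw [coeff_monomial, if_neg]
      exact fun h => hne (expMap_injective V hV h)
    · intro h; exact absurd hm h
  · rw [Finset.sum_eq_zero]
    · exact (notMem_support_iff.mp hm).symm
    · intro m' hm'
      rw [coeff_monomial, if_neg]
      intro h
      exact hm (expMap_injective V hV h ▸ hm')

/-- **Coefficients of `θ f` off the image of the exponent map vanish.** [folklore] -/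
theorem coeff_theta_eq_zero (V : Matrix (Fin n) (Fin n) ℕ) (f : MvPolynomial (Fin n) k) (e : Fin n →₀ ℕ)
    (he : ∀ m : Fin n →₀ ℕ, (Finsupp.equivFunOnFinite.symm (V.mulVec ⇑m) : Fin n →₀ ℕ) ≠ e) :
    coeff e (aeval (fun j : Fin n => ∏ i : Fin n, (X i : MvPolynomial (Fin n) k) ^ V i j) f) = 0 := by
  classical
  rw [theta_eq_sum, coeff_sum]
  refine Finset.sum_eq_zero fun m _ => ?_
  rw [coeff_monomial, if_neg (he m)]

/-- **Monomials of `f` under a factorisation `θ f = Y^d · g`**: for `m ∈ supp f`, `d ≤ V·m` and `coeff (V·m - d) g = coeff m f`. [folklore] -/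
theorem le_and_coeff_of_factor (V : Matrix (Fin n) (Fin n) ℕ) (hV : IsUnit (V.map (Nat.cast : ℕ → ℤ)).det)
    (f g : MvPolynomial (Fin n) k) (d : Fin n →₀ ℕ)
    (hg : aeval (fun j : Fin n => ∏ i : Fin n, (X i : MvPolynomial (Fin n) k) ^ V i j) f = monomial d 1 * g)
    (m : Fin n →₀ ℕ) (hm : m ∈ f.support) :
    d ≤ Finsupp.equivFunOnFinite.symm (V.mulVec ⇑m) ∧
      coeff (Finsupp.equivFunOnFinite.symm (V.mulVec ⇑m) - d) g = coeff m f := by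
  classical
  have h := coeff_theta_apply V hV f m
  rw [hg, coeff_monomial_mul'] at h
  by_cases hle : d ≤ Finsupp.equivFunOnFinite.symm (V.mulVec ⇑m)
  · rw [if_pos hle, one_mul] at h
    exact ⟨hle, h⟩
  · rw [if_neg hle] at h
    exact absurd h.symm (mem_support_iff.mp hm)

/-- **Monomials of `g` under a factorisation `θ f = Y^d · g`**: for `e ∈ supp g`, `e + d = V·m` for some `m` with `coeff m f = coeff e g`.
[folklore] -/
theorem exists_of_coeff_ne_zero_of_factor (V : Matrix (Fin n) (Fin n) ℕ) (hV : IsUnit (V.map (Nat.cast : ℕ → ℤ)).det)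
    (f g : MvPolynomial (Fin n) k) (d : Fin n →₀ ℕ)
    (hg : aeval (fun j : Fin n => ∏ i : Fin n, (X i : MvPolynomial (Fin n) k) ^ V i j) f = monomial d 1 * g)
    (e : Fin n →₀ ℕ) (he : coeff e g ≠ 0) :
    ∃ m : Fin n →₀ ℕ, Finsupp.equivFunOnFinite.symm (V.mulVec ⇑m) = e + d ∧ coeff m f = coeff e g := by
  classical
  by_contra hcon
  push Not at hcon
  -- if `e + d` is not of the form `V·m` with the right coefficient, compare coefficients of `θ f = Y^d g` at `e + d`
  have h1 : coeff (e + d) (aeval (fun j : Fin n => ∏ i : Fin n, (X i : MvPolynomial (Fin n) k) ^ V i j) f) = coeff e g := by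
    rw [hg, coeff_monomial_mul', if_pos le_add_self, one_mul, add_tsub_cancel_right]
  by_cases hex : ∃ m : Fin n →₀ ℕ, (Finsupp.equivFunOnFinite.symm (V.mulVec ⇑m) : Fin n →₀ ℕ) = e + d
  · obtain ⟨m, hm⟩ := hex
    have h2 := coeff_theta_apply V hV f m
    rw [hm, h1] at h2
    exact hcon m hm h2.symm
  · push Not at hex
    rw [coeff_theta_eq_zero V f (e + d) hex] at h1
    exact he h1.symm

/-! ## Setting the `S`-coordinates to zero; the face weight; the chart identity -/

/-- The substitution `Yᵢ ↦ 0 (i ∈ S)` on monomials: it keeps the monomial if no `S`-coordinate occurs, and kills it otherwise. [folklore] -/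
theorem substZero_monomial (S : Finset (Fin n)) (e : Fin n →₀ ℕ) (c : k) :
    aeval (fun i : Fin n => if i ∈ S then (0 : MvPolynomial (Fin n) k) else X i) (monomial e c) =
      if (∀ i ∈ S, e i = 0) then monomial e c else 0 := by
  classical
  rw [aeval_monomial, algebraMap_eq, Finsupp.prod_fintype _ _ (fun i => by simp)]
  by_cases h : ∀ i ∈ S, e i = 0
  · rw [if_pos h, monomial_eq, Finsupp.prod_fintype _ _ (fun i => by simp)]
    congr 1
    refine Finset.prod_congr rfl fun i _ => ?_
    by_cases hi : i ∈ S
    · rw [if_pos hi, h i hi, pow_zero, pow_zero]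
    · rw [if_neg hi]
  · rw [if_neg h]
    push Not at h
    obtain ⟨i, hi, hei⟩ := h
    have h0 : (if i ∈ S then (0 : MvPolynomial (Fin n) k) else X i) ^ e i = 0 := by
      rw [if_pos hi, zero_pow hei]
    rw [Finset.prod_eq_zero (Finset.mem_univ i) h0, mul_zero]

/-- Coefficients after setting the `S`-coordinates to zero. [folklore] -/
theorem coeff_substZero (S : Finset (Fin n)) (g : MvPolynomial (Fin n) k) (e : Fin n →₀ ℕ) :
    coeff e (aeval (fun i : Fin n => if i ∈ S then (0 : MvPolynomial (Fin n) k) else X i) g) =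
      if (∀ i ∈ S, e i = 0) then coeff e g else 0 := by
  classical
  conv_lhs => rw [g.as_sum, map_sum, coeff_sum]
  simp_rw [substZero_monomial]
  by_cases he : ∀ i ∈ S, e i = 0
  · rw [if_pos he]
    by_cases hmem : e ∈ g.support
    · rw [Finset.sum_eq_single e]
      · rw [if_pos he, coeff_monomial, if_pos rfl]
      · intro e' _ hne
        split_ifs
        · rw [coeff_monomial, if_neg hne]
        · rw [coeff_zero]
      · intro h; exact absurd hmem h
    · rw [Finset.sum_eq_zero, (notMem_support_iff.mp hmem)]
      intro e' he'
      split_ifs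
      · rw [coeff_monomial, if_neg]
        rintro rfl
        exact hmem he'
      · rw [coeff_zero]
  · rw [if_neg he]
    refine Finset.sum_eq_zero fun e' _ => ?_
    split_ifs with h'
    · rw [coeff_monomial, if_neg]
      rintro rfl
      exact he h'
    · rw [coeff_zero]

/-- The weight of the face cut out by `w = Σ_{i ∈ S} vᵢ`: `weight w m = Σ_{i ∈ S} (V·m)ᵢ`. [folklore] -/
theorem weight_face_eq (V : Matrix (Fin n) (Fin n) ℕ) (S : Finset (Fin n)) (m : Fin n →₀ ℕ) :
    Finsupp.weight (fun j : Fin n => ∑ i ∈ S, V i j) m =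
      ∑ i ∈ S, (Finsupp.equivFunOnFinite.symm (V.mulVec ⇑m) : Fin n →₀ ℕ) i := by
  rw [Finsupp.weight_apply, Finsupp.sum_fintype _ _ (fun _ => by simp)]
  simp_rw [expMap_apply, smul_eq_mul, Finset.mul_sum]
  rw [Finset.sum_comm]
  refine Finset.sum_congr rfl fun i _ => Finset.sum_congr rfl fun j _ => ?_
  ring

/-- **THE CHART IDENTITY** (B4).  If `θ f = Y^d · g` for a unimodular `V`, then `Y^d · g(Y_S = 0) = θ(in_w f)` for the face weight
`w = Σ_{i∈S} vᵢ` and the initial degree `D = Σ_{i∈S} dᵢ`: the monomials of `g` free of the `S`-coordinates are exactly the images of the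
monomials of `f` on the face. [folklore] -/
theorem monomial_mul_substZero_eq_theta_component (V : Matrix (Fin n) (Fin n) ℕ)
    (hV : IsUnit (V.map (Nat.cast : ℕ → ℤ)).det) (f g : MvPolynomial (Fin n) k) (d : Fin n →₀ ℕ)
    (hg : aeval (fun j : Fin n => ∏ i : Fin n, (X i : MvPolynomial (Fin n) k) ^ V i j) f = monomial d 1 * g)
    (S : Finset (Fin n)) :
    monomial d 1 * aeval (fun i : Fin n => if i ∈ S then (0 : MvPolynomial (Fin n) k) else X i) g =
      aeval (fun j : Fin n => ∏ i : Fin n, (X i : MvPolynomial (Fin n) k) ^ V i j)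
        (weightedHomogeneousComponent (fun j : Fin n => ∑ i ∈ S, V i j) (∑ i ∈ S, d i) f) := by
  classical
  ext e'
  rw [coeff_monomial_mul']
  by_cases hex : ∃ m : Fin n →₀ ℕ, (Finsupp.equivFunOnFinite.symm (V.mulVec ⇑m) : Fin n →₀ ℕ) = e'
  · obtain ⟨m, rfl⟩ := hex
    rw [coeff_theta_apply V hV, coeff_weightedHomogeneousComponent, weight_face_eq]
    by_cases hmf : m ∈ f.support
    · obtain ⟨hle, hcoef⟩ := le_and_coeff_of_factor V hV f g d hg m hmf
      rw [if_pos hle, one_mul, coeff_substZero, hcoef]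
      have hle' : ∀ i, d i ≤ (Finsupp.equivFunOnFinite.symm (V.mulVec ⇑m) : Fin n →₀ ℕ) i := fun i => hle i
      have key : (∀ i ∈ S, (Finsupp.equivFunOnFinite.symm (V.mulVec ⇑m) - d : Fin n →₀ ℕ) i = 0) ↔
          ∑ i ∈ S, (Finsupp.equivFunOnFinite.symm (V.mulVec ⇑m) : Fin n →₀ ℕ) i = ∑ i ∈ S, d i := by
        rw [eq_comm, Finset.sum_eq_sum_iff_of_le (fun i _ => hle' i)]
        refine forall₂_congr fun i _ => ?_
        rw [Finsupp.tsub_apply, tsub_eq_zero_iff_le]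
        exact ⟨fun h => le_antisymm (hle' i) h, fun h => h ▸ le_rfl⟩
      by_cases hw : ∑ i ∈ S, (Finsupp.equivFunOnFinite.symm (V.mulVec ⇑m) : Fin n →₀ ℕ) i = ∑ i ∈ S, d i
      · rw [if_pos (key.mpr hw), if_pos hw]
      · rw [if_neg (fun h => hw (key.mp h)), if_neg hw]
    · have hc : coeff m f = 0 := notMem_support_iff.mp hmf
      rw [hc, ite_self]
      split_ifs with hle
      · rw [one_mul, coeff_substZero]
        split_ifs with hS
        · by_contra hne
          obtain ⟨m', hm', hcm'⟩ := exists_of_coeff_ne_zero_of_factor V hV f g d hg _ hne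
          rw [tsub_add_cancel_of_le hle] at hm'
          have : m' = m := expMap_injective V hV hm'
          rw [this, hc] at hcm'
          exact hne hcm'.symm
        · rfl
      · rfl
  · push Not at hex
    rw [coeff_theta_eq_zero V _ e' hex]
    split_ifs with hle
    · rw [one_mul, coeff_substZero]
      split_ifs with hS
      · by_contra hne
        obtain ⟨m', hm', -⟩ := exists_of_coeff_ne_zero_of_factor V hV f g d hg _ hne
        rw [tsub_add_cancel_of_le hle] at hm'
        exact hex m' hm'
      · rfl
    · rfl

/-- **The face degree is the initial degree** (B4): under `θ f = Y^d · g` and face compatibility (`hface`: some monomial of `f` attains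
`(V·m)ᵢ = dᵢ` for all `i ∈ S`), `D = Σ_{i∈S} dᵢ` is the `w`-initial degree of `f`: the component of degree `D` is non-zero and all lower
components vanish. [folklore] -/
theorem isInitialDegree_face (V : Matrix (Fin n) (Fin n) ℕ) (hV : IsUnit (V.map (Nat.cast : ℕ → ℤ)).det)
    (f g : MvPolynomial (Fin n) k) (d : Fin n →₀ ℕ)
    (hg : aeval (fun j : Fin n => ∏ i : Fin n, (X i : MvPolynomial (Fin n) k) ^ V i j) f = monomial d 1 * g)
    (S : Finset (Fin n)) (hface : ∃ m ∈ f.support, ∀ i ∈ S, ∑ j : Fin n, V i j * m j = d i) :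
    weightedHomogeneousComponent (fun j : Fin n => ∑ i ∈ S, V i j) (∑ i ∈ S, d i) f ≠ 0 ∧
      ∀ D' < ∑ i ∈ S, d i, weightedHomogeneousComponent (fun j : Fin n => ∑ i ∈ S, V i j) D' f = 0 := by
  classical
  constructor
  · obtain ⟨m, hm, hmd⟩ := hface
    intro h0
    have hc := congrArg (coeff m) h0
    rw [coeff_weightedHomogeneousComponent, weight_face_eq, coeff_zero] at hc
    have hw : ∑ i ∈ S, (Finsupp.equivFunOnFinite.symm (V.mulVec ⇑m) : Fin n →₀ ℕ) i = ∑ i ∈ S, d i :=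
      Finset.sum_congr rfl fun i hi => by rw [expMap_apply, hmd i hi]
    rw [if_pos hw] at hc
    exact (mem_support_iff.mp hm) hc
  · intro D' hD'
    apply weightedHomogeneousComponent_eq_zero'
    intro m hm
    rw [weight_face_eq]
    have hle := (le_and_coeff_of_factor V hV f g d hg m hm).1
    have hge : ∑ i ∈ S, d i ≤ ∑ i ∈ S, (Finsupp.equivFunOnFinite.symm (V.mulVec ⇑m) : Fin n →₀ ℕ) i :=
      Finset.sum_le_sum fun i _ => hle i
    omega

end Summit.ResolutionOfSingularities.ResolutionOfSingularities.Theorems.FInjectiveMacaulayfication.ToricChartFedder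

end
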